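import Literature.Computability.QuantumComplexity.PolynomialMethod
import Summits.QuantumAdvantage.QuantumAdvantage.Theorems.WbwVerifiableLineNoSpeedup.Negative.QueryReindex
import Summits.QuantumAdvantage.QuantumAdvantage.Theorems.SosSandwichPseudoBoundedAAQuerySimulable
import Mathlib.Data.Matrix.Block
import HarnessLib

/-!
# The class `Q_T` of quantum query acceptance probabilities is RESTRICTION-CLOSED (tree model `QQueryAlg`)

Support theorem for route `SosSandwich` (crux `PseudoBoundedAA`, stmt-QuantumAdvantage-15237; its "retreat to
`Q_T`" kill criterion and the Aaronson–Ambainis simulation, which only ever needs influential variables of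
RESTRICTIONS of the acceptance polynomial): for a `T`-query quantum algorithm `A : QQueryAlg N`
(Beals–Buhrman–Cleve–Mosca–de Wolf model of `Literature/Computability/Cryptography/QuantumQuery.lean`), a position
`i` and a constant `c`, we build `restrictAlg A i c : QQueryAlg N` with the SAME number of queries and

  `acceptProb (restrictAlg A i c) x = acceptProb A (Function.update x i c)`   (`restrictAlg_acceptProb`),

i.e. hard-wiring an input bit keeps one inside `Q_T` (one extra ancilla qubit in the workspace).  Standard but
never written down in the tree; the construction is the "|+⟩-slot" conjugation: on the components that query
index `i`, the target bit is swapped into a fresh ancilla and replaced by `|+⟩ = H|0⟩`, on which the XOR-oracle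
acts trivially whatever `x_i` is; after the query the swap is undone and `X^c` applied.  Formally (template:
`Theorems/WbwVerifiableLineNoSpeedup/Negative/QueryReindex.lean`, whose `lift`/`extU`/`foldl_map_comm` we reuse):
basis `Fin N × Bool × (W × Bool)`, embedding `emb (k,b,w) = (k,b,(w,false))`; the 4×4 gadget `S|b,a⟩ = (H|a⟩)⊗|b⟩`
(`gadgetS`), `V = blockAt i S`, `M = blockAt i (S·X^c)` (block-diagonal in the coordinates `(b,a) × (k,w)`,
`coord`); unitaries `U'_0 = V·Ext(U_0)`, `U'_{j+1} = V·Ext(U_{j+1})·M⁻¹` (`restrictUnitaries`); the key identity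
`O_x · V · lift ψ = M · lift (O_{x[i:=c]} ψ)` (`oracle_gadV_lift`, from `X^β S e_(b,0) = S e_(b,0)`); hence
`finalState' = V · lift (finalState on x[i:=c])` (`restrictAlg_finalState`, by `foldl_map_comm`) and, with the
accepting set `{(k,b,(w,0)) : k ≠ i, (k,b,w) ∈ acc} ∪ {(i,b',(w,b)) : (i,b,w) ∈ acc}` (the final `V` spreads the
index-`i` mass `1/2–1/2` over `b'`), equal acceptance probabilities.  Generic in nature — a librarian may relocate
it next to `QueryReindex` under `Literature/Computability/QuantumComplexity/`.  Sorry-free.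

Sources: BealsEtAl2001 §2 (the model); BuhrmanDeWolf2002 §3 ("we may fix some input bits"); AaronsonAmbainis2014
Thm. 21 (restrictions in the simulation).
-/

noncomputable section

set_option linter.dupNamespace false

namespace Summit.QuantumAdvantage.QuantumAdvantage.Theorems.SosSandwich.QueryRestrict

open Matrix Literature.Computability.Cryptography Literature.Computability.QuantumComplexity
open Summit.QuantumAdvantage.QuantumAdvantage.Theorems.WbwVerifiableLineNoSpeedup.Negative.QueryReindex

/-- The Hadamard entry `H_{b',a} = ±1/√2` (`−` iff `b' ∧ a`). -/
def hadEntry (b' a : Bool) : ℂ := if b' && a then -(1 / Real.sqrt 2 : ℝ) else (1 / Real.sqrt 2 : ℝ)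

/-- The gadget `S|b,a⟩ = (H|a⟩)_first ⊗ |b⟩_second`: entry `⟨b',a'| S |b,a⟩ = H_{b',a}·[a' = b]`. -/
def gadgetS : Matrix (Bool × Bool) (Bool × Bool) ℂ :=
  Matrix.of fun p q => if p.2 = q.1 then hadEntry p.1 q.2 else 0

/-- `X^c` on the first slot: `(b,a) ↦ (b xor c, a)`. -/
def xFirst (c : Bool) : Matrix (Bool × Bool) (Bool × Bool) ℂ :=
  Matrix.of fun p q => if p.1 = (q.1 ^^ c) ∧ p.2 = q.2 then 1 else 0

/-- The gadget `S` is unitary (a 4×4 check). [folklore] -/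
theorem gadgetS_mem_unitaryGroup : gadgetS ∈ Matrix.unitaryGroup (Bool × Bool) ℂ := by
  rw [Matrix.mem_unitaryGroup_iff]
  ext ⟨b1, a1⟩ ⟨b2, a2⟩
  simp only [Matrix.mul_apply, Matrix.star_apply, gadgetS, Matrix.of_apply, Fintype.sum_prod_type,
    Fintype.sum_bool, Matrix.one_apply, Prod.mk.injEq]
  -- `(√2)⁻¹·(√2)⁻¹ = 1/2` (kept local: the tree's `…ModularTensorCategories.inv_sqrt_two_mul_inv_sqrt_two`)
  have h2 : ((Real.sqrt 2 : ℝ) : ℂ)⁻¹ * ((Real.sqrt 2 : ℝ) : ℂ)⁻¹ = 1 / 2 := by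
    rw [← mul_inv, ← Complex.ofReal_mul, Real.mul_self_sqrt (by norm_num : (0:ℝ) ≤ 2)]
    push_cast
    norm_num
  cases b1 <;> cases a1 <;> cases b2 <;> cases a2 <;> simp [hadEntry, Complex.conj_ofReal] <;>
    (rw [h2]; norm_num)

/-- `X^c` on the first slot is unitary (a permutation). [folklore] -/
theorem xFirst_mem_unitaryGroup (c : Bool) : xFirst c ∈ Matrix.unitaryGroup (Bool × Bool) ℂ := by
  rw [Matrix.mem_unitaryGroup_iff]
  ext ⟨b1, a1⟩ ⟨b2, a2⟩
  simp only [Matrix.mul_apply, Matrix.star_apply, xFirst, Matrix.of_apply, Fintype.sum_prod_type,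
    Fintype.sum_bool, Matrix.one_apply, Prod.mk.injEq]
  cases b1 <;> cases a1 <;> cases b2 <;> cases a2 <;> cases c <;> simp

/-- The invariance that makes the trick work: `X^β · S · e_(b,false) = S · e_(b,false)` for every `β`. -/
theorem xFirst_mul_gadgetS_single (β b : Bool) :
    xFirst β *ᵥ (gadgetS *ᵥ Pi.single (b, false) 1) = gadgetS *ᵥ Pi.single (b, false) 1 := by
  funext ⟨b1, a1⟩
  simp only [Matrix.mulVec, dotProduct, xFirst, gadgetS, Matrix.of_apply, Fintype.sum_prod_type,
    Fintype.sum_bool, Pi.single_apply, Prod.mk.injEq]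
  cases β <;> cases b <;> cases b1 <;> cases a1 <;> simp [hadEntry]

variable {N : ℕ}

/-- Coordinates: `(b,a) × (k,w) ≃ k, b, (w, a)`. -/
def coord (W : Type) : (Bool × Bool) × (Fin N × W) ≃ Fin N × Bool × (W × Bool) where
  toFun p := (p.2.1, p.1.1, (p.2.2, p.1.2))
  invFun s := ((s.2.1, s.2.2.2), (s.1, s.2.2.1))
  left_inv p := by obtain ⟨⟨b, a⟩, k, w⟩ := p; rfl
  right_inv s := by obtain ⟨k, b, w, a⟩ := s; rfl

/-- A block-diagonal unitary: block `B` at index `i`, identity elsewhere. -/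
def blockAt (W : Type) [Fintype W] [DecidableEq W] (i : Fin N) (B : Matrix (Bool × Bool) (Bool × Bool) ℂ) :
    Matrix (Fin N × Bool × (W × Bool)) (Fin N × Bool × (W × Bool)) ℂ :=
  Matrix.reindex (coord W) (coord W) (Matrix.blockDiagonal fun kw : Fin N × W => if kw.1 = i then B else 1)

/-- Block-diagonal matrices with unitary blocks are unitary. -/
theorem blockDiagonal_mem_unitaryGroup {o m : Type} [Fintype o] [DecidableEq o] [Fintype m] [DecidableEq m]
    (B : o → Matrix m m ℂ) (hB : ∀ k, B k ∈ Matrix.unitaryGroup m ℂ) :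
    Matrix.blockDiagonal B ∈ Matrix.unitaryGroup (m × o) ℂ := by
  rw [Matrix.mem_unitaryGroup_iff, Matrix.star_eq_conjTranspose, Matrix.blockDiagonal_conjTranspose,
    ← Matrix.blockDiagonal_mul]
  have h : (fun k => B k * (B k)ᴴ) = 1 := by
    funext k
    have := Matrix.mem_unitaryGroup_iff.mp (hB k)
    rw [Matrix.star_eq_conjTranspose] at this
    exact this
  rw [h, Matrix.blockDiagonal_one]

/-- `blockAt i B` is unitary when `B` is. [folklore] -/
theorem blockAt_mem_unitaryGroup (W : Type) [Fintype W] [DecidableEq W] (i : Fin N)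
    {B : Matrix (Bool × Bool) (Bool × Bool) ℂ} (hB : B ∈ Matrix.unitaryGroup (Bool × Bool) ℂ) :
    blockAt W i B ∈ Matrix.unitaryGroup (Fin N × Bool × (W × Bool)) ℂ := by
  unfold blockAt
  refine reindex_mem_unitaryGroup' _ (blockDiagonal_mem_unitaryGroup _ fun kw => ?_)
  by_cases h : kw.1 = i
  · rw [if_pos h]; exact hB
  · rw [if_neg h]; exact Submonoid.one_mem _

/-- Entrywise action of `blockAt`: only the `(b,a)`-slot of the same `(k,w)` is mixed, by `B` at index `i` and by
the identity elsewhere. -/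
theorem blockAt_mulVec_apply (W : Type) [Fintype W] [DecidableEq W] (i : Fin N)
    (B : Matrix (Bool × Bool) (Bool × Bool) ℂ) (φ : Fin N × Bool × (W × Bool) → ℂ) (k : Fin N) (b : Bool)
    (w : W) (a : Bool) :
    (blockAt W i B *ᵥ φ) (k, b, (w, a)) =
      ∑ p : Bool × Bool, (if k = i then B else 1) (b, a) p * φ (k, p.1, (w, p.2)) := by
  unfold blockAt
  rw [Matrix.reindex_apply, Matrix.submatrix_mulVec_equiv, Function.comp_apply, Matrix.mulVec, dotProduct]
  have hsymm : (coord (N := N) W).symm (k, b, (w, a)) = ((b, a), (k, w)) := rfl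
  rw [hsymm, Fintype.sum_prod_type]
  rw [Finset.sum_comm]
  rw [Finset.sum_eq_single (k, w)]
  · refine Finset.sum_congr rfl fun p _ => ?_
    rw [Matrix.blockDiagonal_apply_eq]
    rfl
  · intro kw _ hne
    refine Finset.sum_eq_zero fun p _ => ?_
    rw [Matrix.blockDiagonal_apply_ne _ _ _ (Ne.symm hne), zero_mul]
  · intro h; exact absurd (Finset.mem_univ _) h

/-- The embedding of the original basis (ancilla `false`). -/
def emb (A : QQueryAlg N) (s : Fin N × Bool × A.W) : Fin N × Bool × (A.W × Bool) := (s.1, s.2.1, (s.2.2, false))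

/-- The basis embedding is injective. [folklore] -/
theorem emb_injective (A : QQueryAlg N) : Function.Injective (emb A) := by
  rintro ⟨k, b, w⟩ ⟨k', b', w'⟩ h
  simp only [emb, Prod.mk.injEq] at h
  obtain ⟨rfl, rfl, rfl, -⟩ := h
  rfl

/-- `V = blockAt i S` as a unitary-group element. [folklore] -/
def gadV (A : QQueryAlg N) (i : Fin N) : Matrix.unitaryGroup (Fin N × Bool × (A.W × Bool)) ℂ :=
  ⟨blockAt A.W i gadgetS, blockAt_mem_unitaryGroup A.W i gadgetS_mem_unitaryGroup⟩

/-- `M = blockAt i (S·X^c)` as a unitary-group element. [folklore] -/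
def gadM (A : QQueryAlg N) (i : Fin N) (c : Bool) : Matrix.unitaryGroup (Fin N × Bool × (A.W × Bool)) ℂ :=
  ⟨blockAt A.W i (gadgetS * xFirst c), blockAt_mem_unitaryGroup A.W i
    (Submonoid.mul_mem _ gadgetS_mem_unitaryGroup (xFirst_mem_unitaryGroup c))⟩

/-- The unitaries of the restricted algorithm: `U'_0 = V·Ext(U_0)`, `U'_{j+1} = V·Ext(U_{j+1})·M⁻¹`. -/
def restrictUnitaries (A : QQueryAlg N) (i : Fin N) (c : Bool) :
    Fin (A.queries + 1) → Matrix.unitaryGroup (Fin N × Bool × (A.W × Bool)) ℂ :=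
  Fin.cases (gadV A i * extU (emb A) (emb_injective A) (A.unitaries 0))
    (fun j => gadV A i * extU (emb A) (emb_injective A) (A.unitaries j.succ) * (gadM A i c)⁻¹)

/-- **The restricted algorithm** (one ancilla qubit; same number of queries).  (`reducible`: its
workspace `A.W × Bool` and instances must unfold for rewriting.) -/
@[reducible] def restrictAlg (A : QQueryAlg N) (i : Fin N) (c : Bool) : QQueryAlg N where
  W := A.W × Bool
  queries := A.queries
  unitaries := restrictUnitaries A i c
  start := emb A A.start
  accept := {s | (s.1 ≠ i ∧ s.2.2.2 = false ∧ (s.1, s.2.1, s.2.2.1) ∈ A.accept) ∨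
    (s.1 = i ∧ (i, s.2.2.2, s.2.2.1) ∈ A.accept)}

/-- The lifted vector: the original amplitude on ancilla `false`, zero on ancilla `true`. -/
theorem lift_emb_apply (A : QQueryAlg N) (ψ : Fin N × Bool × A.W → ℂ) (k : Fin N) (b : Bool) (w : A.W)
    (a : Bool) :
    lift (emb A) (emb_injective A) ψ (k, b, (w, a)) = if a = false then ψ (k, b, w) else 0 := by
  cases a
  · rw [if_pos rfl]
    exact lift_e (emb A) (emb_injective A) ψ (k, b, w)
  · rw [if_neg (by decide)]
    refine lift_of_not_mem _ _ _ ?_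
    rintro ⟨⟨k', b', w'⟩, h⟩
    simp [emb] at h

/-- KEY IDENTITY: `O_x · V · lift ψ = M · lift (O_{x[i:=c]} ψ)`. -/
theorem oracle_gadV_lift (A : QQueryAlg N) (i : Fin N) (c : Bool) (x : Fin N → Bool)
    (ψ : Fin N × Bool × A.W → ℂ) :
    queryOracle (W := A.W × Bool) x *ᵥ ((gadV A i).1 *ᵥ lift (emb A) (emb_injective A) ψ) =
      (gadM A i c).1 *ᵥ lift (emb A) (emb_injective A) (queryOracle (Function.update x i c) *ᵥ ψ) := by
  funext s
  obtain ⟨k, b, w, a⟩ := s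
  rw [queryOracle_mulVec_apply]
  change (blockAt A.W i gadgetS *ᵥ lift (emb A) (emb_injective A) ψ) (k, (b ^^ x k), (w, a)) =
    (blockAt A.W i (gadgetS * xFirst c) *ᵥ lift (emb A) (emb_injective A)
      (queryOracle (Function.update x i c) *ᵥ ψ)) (k, b, (w, a))
  rw [blockAt_mulVec_apply, blockAt_mulVec_apply]
  simp only [lift_emb_apply, queryOracle_mulVec_apply]
  by_cases hk : k = i
  · subst hk
    simp only [if_true, Function.update_self, Fintype.sum_prod_type, Fintype.sum_bool, gadgetS, xFirst,
      Matrix.mul_apply, Matrix.of_apply]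
    cases a <;> cases b <;> cases c <;> cases x k <;> simp [hadEntry]
  · simp only [if_neg hk, Function.update_of_ne hk, Fintype.sum_prod_type, Fintype.sum_bool, Matrix.one_apply,
      Prod.mk.injEq]
    cases a <;> cases b <;> cases x k <;> simp

/-- `M⁻¹ · M · v = v` for a unitary-group element. -/
theorem inv_mulVec_mulVec {n : Type} [Fintype n] [DecidableEq n] (M : Matrix.unitaryGroup n ℂ) (v : n → ℂ) :
    (M⁻¹).1 *ᵥ (M.1 *ᵥ v) = v := by
  rw [Matrix.mulVec_mulVec, Matrix.UnitaryGroup.inv_val, Matrix.UnitaryGroup.star_mul_self,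
    Matrix.one_mulVec]

/-- Final state of the restricted algorithm = `V · lift` of the original final state on `x[i:=c]`. -/
theorem restrictAlg_finalState (A : QQueryAlg N) (i : Fin N) (c : Bool) (x : Fin N → Bool) :
    (restrictAlg A i c).finalState x =
      (gadV A i).1 *ᵥ lift (emb A) (emb_injective A) (A.finalState (Function.update x i c)) := by
  unfold QQueryAlg.finalState
  show Fin.foldl A.queries
      (fun ψ j => (restrictUnitaries A i c j.succ : Matrix _ _ ℂ) *ᵥ (queryOracle (W := A.W × Bool) x *ᵥ ψ))
      ((restrictUnitaries A i c 0 : Matrix _ _ ℂ) *ᵥ Pi.single (emb A A.start) 1) = _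
  have hinit : (restrictUnitaries A i c 0 : Matrix _ _ ℂ) *ᵥ Pi.single (emb A A.start) 1
      = (gadV A i).1 *ᵥ lift (emb A) (emb_injective A) ((A.unitaries 0).1 *ᵥ Pi.single A.start 1) := by
    rw [← extMatrix_mulVec_lift, lift_single, Matrix.mulVec_mulVec]
    rfl
  rw [hinit]
  refine foldl_map_comm A.queries _ _ (fun ψ => (gadV A i).1 *ᵥ lift (emb A) (emb_injective A) ψ)
    (fun ψ j => ?_) _
  show (gadV A i).1 *ᵥ lift (emb A) (emb_injective A)
      ((A.unitaries j.succ).1 *ᵥ (queryOracle (Function.update x i c) *ᵥ ψ)) =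
    ((gadV A i * extU (emb A) (emb_injective A) (A.unitaries j.succ) * (gadM A i c)⁻¹ :
        Matrix.unitaryGroup _ ℂ) : Matrix _ _ ℂ) *ᵥ
      (queryOracle x *ᵥ ((gadV A i).1 *ᵥ lift (emb A) (emb_injective A) ψ))
  rw [oracle_gadV_lift A i c x ψ, Matrix.UnitaryGroup.mul_val, Matrix.UnitaryGroup.mul_val,
    ← Matrix.mulVec_mulVec, ← Matrix.mulVec_mulVec, inv_mulVec_mulVec, ← extMatrix_mulVec_lift]
  rfl

/-- Entries of the restricted final state: at index `k ≠ i` the original amplitude on ancilla `false`; at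
index `i` the original amplitude of `(i, a, w)` spread with weight `1/√2` over the two values of the `b`-slot. -/
theorem restrictAlg_finalState_apply (A : QQueryAlg N) (i : Fin N) (c : Bool) (x : Fin N → Bool)
    (k : Fin N) (b : Bool) (w : A.W) (a : Bool) :
    (restrictAlg A i c).finalState x (k, b, (w, a)) =
      if k = i then ((1 / Real.sqrt 2 : ℝ) : ℂ) * A.finalState (Function.update x i c) (i, a, w)
      else (if a = false then A.finalState (Function.update x i c) (k, b, w) else 0) := by
  rw [restrictAlg_finalState]
  change (blockAt A.W i gadgetS *ᵥ lift (emb A) (emb_injective A) (A.finalState (Function.update x i c)))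
      (k, b, (w, a)) = _
  rw [blockAt_mulVec_apply]
  simp only [lift_emb_apply]
  by_cases hk : k = i
  · subst hk
    simp only [if_true, Fintype.sum_prod_type, Fintype.sum_bool, gadgetS, Matrix.of_apply]
    cases a <;> cases b <;> simp [hadEntry]
  · simp only [if_neg hk, Fintype.sum_prod_type, Fintype.sum_bool, Matrix.one_apply, Prod.mk.injEq]
    cases a <;> cases b <;> simp

/-- `‖(1/√2)·z‖² = ‖z‖²/2`. -/
theorem norm_invSqrtTwo_mul_sq (z : ℂ) : ‖((1 / Real.sqrt 2 : ℝ) : ℂ) * z‖ ^ 2 = ‖z‖ ^ 2 / 2 := by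
  rw [norm_mul, Complex.norm_real, Real.norm_of_nonneg (by positivity), mul_pow, div_pow, one_pow,
    Real.sq_sqrt (by norm_num : (0:ℝ) ≤ 2)]
  ring

/-- **`Q_T` is restriction-closed**: `P[restrictAlg A i c accepts x] = P[A accepts x[i:=c]]`. -/
theorem restrictAlg_acceptProb (A : QQueryAlg N) (i : Fin N) (c : Bool) (x : Fin N → Bool) :
    (restrictAlg A i c).acceptProb x = A.acceptProb (Function.update x i c) := by
  classical
  unfold QQueryAlg.acceptProb
  rw [Finset.sum_filter, Finset.sum_filter]
  set ψ := A.finalState (Function.update x i c) with hψ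
  have hmem : ∀ (k : Fin N) (b : Bool) (w : A.W) (a : Bool),
      ((k, b, (w, a)) ∈ (restrictAlg A i c).accept) =
        ((k ≠ i ∧ a = false ∧ (k, b, w) ∈ A.accept) ∨ (k = i ∧ (i, a, w) ∈ A.accept)) := fun k b w a => rfl
  have happ : ∀ (k : Fin N) (b : Bool) (w : A.W) (a : Bool),
      (restrictAlg A i c).finalState x (k, b, (w, a)) =
        if k = i then ((1 / Real.sqrt 2 : ℝ) : ℂ) * ψ (i, a, w) else (if a = false then ψ (k, b, w) else 0) :=
    fun k b w a => restrictAlg_finalState_apply A i c x k b w a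
  simp only [Fintype.sum_prod_type, hmem, happ]
  refine Finset.sum_congr rfl fun k _ => ?_
  by_cases hk : k = i
  · subst hk
    simp only [if_true, ne_eq, not_true_eq_false, false_and, false_or, true_and, norm_invSqrtTwo_mul_sq,
      Fintype.sum_bool]
    rw [← Finset.sum_add_distrib, ← Finset.sum_add_distrib]
    refine Finset.sum_congr rfl fun w _ => ?_
    split_ifs <;> ring
  · simp only [ne_eq, hk, not_false_eq_true, true_and, false_and, or_false,
      Fintype.sum_bool, Bool.true_eq_false, if_false, zero_add, if_true]

/-! ### Consequence: the Aaronson–Ambainis conjecture for QUANTUM acceptance probabilities already gives Conjecture 4 -/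

/-- **Aaronson–Ambainis Thm 7 (i) with its MINIMAL hypothesis.**  If the Aaronson–Ambainis influence bound holds
for the acceptance probabilities of quantum query algorithms only ("AA_Q": every polynomial with the cube values
of a `T ≥ 1`-query algorithm and `Var ≥ ε > 0` has a variable of influence `≥ C (ε/T)^c`), then
`QuantumQuerySimulable` (AA14 Conjecture 4) holds, with `C' = (⌈16·4^c/C⌉+1)·2^{4c+2}`, `k = 4c+2`.  The
simulation `simTree` only queries RESTRICTIONS of the acceptance polynomial, and by `restrictAlg_acceptProb`
these are again acceptance probabilities of `T`-query algorithms (the invariant class of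
`SimTreePB.simTree_depth_error_le_of_inv`).  Compare `quantumQuerySimulable_of_pseudoBoundedAA` (hypothesis on
the larger SOS class `K_T ⊇ Q_T`) and the tree's `AaronsonAmbainis2014_thm7_holds` (all bounded polynomials).
[cite: AaronsonAmbainis2014, Thm. 7 (i) and Thm. 21] -/
theorem quantumQuerySimulable_of_aaQuery
    (hAAQ : ∃ (c : ℕ) (C : ℝ), 0 < C ∧ ∀ (N : ℕ) (Q : QQueryAlg N) (p : MvPolynomial (Fin N) ℝ) (ε : ℝ),
      1 ≤ Q.queries → (∀ x, evalBool p x = Q.acceptProb x) → 0 < ε → ε ≤ boolVariance p →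
        ∃ i : Fin N, C * (ε / Q.queries) ^ c ≤ influence i p) :
    QuantumQuerySimulable := by
  obtain ⟨c, C₀, hC₀, H⟩ := hAAQ
  refine ⟨(Nat.ceil (16 * 2 ^ c * 2 ^ c / C₀) + 1) * 2 ^ (4 * c + 2), 4 * c + 2, ?_⟩
  intro N Q ε δ hε hε1 hδ hδ1
  rcases Nat.eq_zero_or_pos Q.queries with hT0 | hTpos
  · refine ⟨RealDecisionTree.leaf (Q.acceptProb fun _ => false), ?_, ?_⟩
    · simp only [RealDecisionTree.depth_leaf, Nat.cast_zero]
      positivity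
    · rw [PBAAQuerySimulable.leaf_simulates_of_queries_eq_zero Q hT0 hε, Finset.card_empty, Nat.cast_zero]
      positivity
  · obtain ⟨p, hpb, hdeg, hval⟩ := PBAAQuerySimulable.exists_pseudoBounded_acceptPoly Q
    set T := Q.queries with hT
    have hd1 : 1 ≤ 2 * T := by omega
    -- the invariant class: cube values of SOME `T`-query algorithm
    let K : MvPolynomial (Fin N) ℝ → Prop := fun q => ∃ Q' : QQueryAlg N, Q'.queries = T ∧
      ∀ x, evalBool q x = Q'.acceptProb x
    have hK : ∀ (q : MvPolynomial (Fin N) ℝ) (i : Fin N) (b : Bool), K q →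
        K (restrictPoly i b q) := by
      rintro q i b ⟨Q', hQ', hq⟩
      refine ⟨restrictAlg Q' i b, hQ', fun x => ?_⟩
      rw [evalBool_restrictPoly, hq, restrictAlg_acceptProb]
    have hH : ∀ (q : MvPolynomial (Fin N) ℝ) (ε' : ℝ), K q → q.totalDegree ≤ 2 * T →
        (∀ x, 0 ≤ evalBool q x ∧ evalBool q x ≤ 1) → 0 < ε' → ε' ≤ boolVariance q →
          ∃ i : Fin N, C₀ * (ε' / (2 * T : ℕ)) ^ c ≤ influence i q := by
      rintro q ε' ⟨Q', hQ', hq⟩ - - hε' hv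
      obtain ⟨i, hi⟩ := H N Q' q ε' (by omega) hq hε' hv
      refine ⟨i, le_trans ?_ hi⟩
      rw [hQ']
      have hTpos' : (0 : ℝ) < T := by exact_mod_cast hTpos
      gcongr
      · omega
    have hKp : K p := ⟨Q, rfl, hval⟩
    obtain ⟨hdepth, herr⟩ :=
      Summit.QuantumAdvantage.QuantumAdvantage.Cruxes.TransferPB.Birth.SimTreePB.simTree_depth_error_le_of_inv
        (c := c) hC₀ hd1 (K := K) hK hH hKp hdeg hpb.bounded hε hε1 hδ hδ1
    refine ⟨_, hdepth.trans ?_, ?_⟩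
    · have hA : (0 : ℝ) ≤ (Nat.ceil (16 * 2 ^ c * 2 ^ c / C₀) + 1 : ℕ) := by positivity
      calc ((Nat.ceil (16 * 2 ^ c * 2 ^ c / C₀) + 1 : ℕ) : ℝ) * (((2 * T : ℕ) : ℝ) / (ε * δ) + 1) ^ (4 * c + 2)
          ≤ ((Nat.ceil (16 * 2 ^ c * 2 ^ c / C₀) + 1 : ℕ) : ℝ) *
              ((2 : ℝ) ^ (4 * c + 2) * ((T : ℝ) / (ε * δ) + 1) ^ (4 * c + 2)) :=
            mul_le_mul_of_nonneg_left (PBAAQuerySimulable.depth_arith T hε hδ (4 * c + 2)) hA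
        _ = (((Nat.ceil (16 * 2 ^ c * 2 ^ c / C₀) + 1) * 2 ^ (4 * c + 2) : ℕ) : ℝ) *
              ((T : ℝ) / (ε * δ) + 1) ^ (4 * c + 2) := by
            push_cast
            ring
    · refine le_trans (le_of_eq ?_) herr
      congr 1
      refine congrArg Finset.card (Finset.filter_congr fun x _ => ?_)
      rw [hval x]

end Summit.QuantumAdvantage.QuantumAdvantage.Theorems.SosSandwich.QueryRestrict

end
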